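import Mathlib.Analysis.SpecialFunctions.SmoothTransition
import Mathlib.Analysis.SpecialFunctions.Pow.Real
import Mathlib.Analysis.Calculus.Deriv.Inv
import Mathlib.Analysis.SpecialFunctions.ExpDeriv
import HarnessLib

/-!
# Hamilton's surgery profile `f(z) = c e^{-p/z}` and Lemma D2.4
(topic `Geometry/Riemannian`)

A brick of the surgery step of Chen–Zhu's Thm. 5.6
(`Literature.Geometry.Riemannian.chenZhu_surgicalStep_admissibleRestart`; Chen–Zhu 2006,
Lemma 5.3 = Hamilton 1997, Thm. D3.1). The `δ`-cutoff surgery of Chen–Zhu 2006, §5, p. 29,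
modifies the metric on the half-neck `z ∈ [0, 4]` conformally by `e^{-2f}` with
"`f(z) = 0` for `z ≤ 0`, `f(z) = c e^{-D/z}` for `z ∈ (0, 3]` … where the small (positive)
constant `c` and big (positive) constant `D` will be determined" in Lemma 5.3; this is
Hamilton's profile (Comm. Anal. Geom. 5 (1997), §4.2, p. 53: "Take `f` to be the function
`f(z) = c e^{-p/(z-λ)}` for `z > λ`, `f(z) = 0` for `0 ≤ z ≤ λ`", here with `λ = 0`, `p = D`).
The profile is Mathlib's `c · expNegInvGlue (z / D)`; this file PROVES Hamilton's elementary
estimates for it (p. 53–54) and **Lemma D2.4** (p. 54): "For any `λ` and any `δ > 0` we can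
choose `c` small enough and `p` large enough so that when `f = c e^{-p/(z-λ)}`:
`e^{2f} - 1 ≤ δ d²f/dz²`, `df/dz ≤ δ d²f/dz²`, `(df/dz)² ≤ δ d²f/dz²` and `d²f/dz² ≤ δ` for
`λ < z ≤ 4λ`" — the input `(s - 1)(N + ρ + τ) ≤ θτ`, `|Df|² ≪ D²f` of the algebraic half of
Thm. D3.1 (`SurgeryPinchingAlgebra.lean`).

Writing `φ(z) = c e^{-D/z}`, `φ₁(z) = (D/z²) φ(z)`, `φ₂(z) = (D/z⁴)(D - 2z) φ(z)` (`z > 0`),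
all in the namespace `SurgeryProfile`:
* `eq_of_pos`, `eq_zero_of_nonpos`, `contDiff`, `nonneg`, `le_const` — the globally smooth
  `z ↦ c · expNegInvGlue (z/D)` is `φ` on `z > 0` and `0` on `z ≤ 0`, with `0 ≤ · ≤ c`;
* `hasDerivAt`, `hasDerivAt_exp`, `hasDerivAt_deriv` — `φ' = φ₁`, `φ₁' = φ₂` on `z > 0`;
* `estimates` — for `0 < z ≤ D/4` (p. 53: "if `p ≥ 4λ` then `p - 2z ≥ p/2`"):
  `φ₂ ≥ D² φ/(2z⁴) > 0`, `φ ≤ (2z⁴/D²) φ₂`, `φ₁ ≤ (2z²/D) φ₂`, `φ₁² ≤ 2c φ₂`, `φ₂ ≤ (D²/z⁴) φ`;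
* `pow_four_mul_exp_neg_le` — `x⁴ e^{-x} ≤ 4⁴ e^{-4}` (p. 53: "`y = x⁴e^{-x}` has its maximum at
  `x = 4`"), whence `deriv2_le` — `φ₂ ≤ 256 e^{-4} c / D²`;
* `exp_two_mul_sub_one_le` — `e^{2φ} - 1 ≤ 2 e^{2c} φ` for `0 ≤ φ ≤ c` (p. 54);
* **`hamilton_lemma_D2_4`** — for every `Z > 0` and `δ > 0` there are `c₀ > 0` and `D₀ > 0`
  such that for all `0 < c ≤ c₀`, `D ≥ D₀`, `0 < z ≤ Z`: `φ₂ > 0`, `e^{2φ} - 1 ≤ δ φ₂`,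
  `φ₁ ≤ δ φ₂`, `φ₁² ≤ δ φ₂`, `φ₂ ≤ δ` and `φ ≤ δ φ₂`.

Everything here is proved; no definitions, no named facts.

## References

* R. S. Hamilton, *Four-manifolds with positive isotropic curvature*, Comm. Anal. Geom. 5 (1997)
  1–92, §4.2, pp. 53–54, Lemma 2.4 (= D2.4). [Hamilton1997]
* B.-L. Chen, X.-P. Zhu, *Ricci flow with surgery on four-manifolds with positive isotropic
  curvature*, J. Differential Geom. 74 (2006) 177–264 (arXiv:math/0504478), §5, p. 29 (the
  function `f`) and Lemma 5.3. [ChenZhu2006]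
-/

noncomputable section

open Real Set

namespace Literature.Geometry.Riemannian

namespace SurgeryProfile

/-! ### The profile and its derivatives -/

/-- On `z > 0` the profile is `c e^{-D/z}` (`D > 0`). [cite: Hamilton1997, §4.2, p. 53] -/
theorem eq_of_pos {c D z : ℝ} (hD : 0 < D) (hz : 0 < z) :
    c * expNegInvGlue (z / D) = c * exp (-D / z) := by
  have hzD : 0 < z / D := div_pos hz hD
  rw [expNegInvGlue, if_neg (not_le.2 hzD), inv_div, neg_div]

/-- On `z ≤ 0` the profile vanishes. [cite: Hamilton1997, §4.2, p. 53] -/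
theorem eq_zero_of_nonpos {c D z : ℝ} (hD : 0 < D) (hz : z ≤ 0) :
    c * expNegInvGlue (z / D) = 0 := by
  rw [expNegInvGlue.zero_of_nonpos (div_nonpos_of_nonpos_of_nonneg hz hD.le), mul_zero]

/-- The profile is smooth on all of `ℝ` (Mathlib's `expNegInvGlue.contDiff`). [folklore] -/
theorem contDiff {c D : ℝ} {n : ℕ∞} : ContDiff ℝ n fun z ↦ c * expNegInvGlue (z / D) :=
  contDiff_const.mul (expNegInvGlue.contDiff.comp (contDiff_id.div_const D))

/-- The profile is non-negative for `c ≥ 0`. [folklore] -/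
theorem nonneg {c D : ℝ} (hc : 0 ≤ c) (z : ℝ) : 0 ≤ c * expNegInvGlue (z / D) :=
  mul_nonneg hc (expNegInvGlue.nonneg _)

/-- The profile is bounded by `c` for `c ≥ 0` ("Note we always have `f ≤ c`", p. 53).
[cite: Hamilton1997, §4.2, p. 53] -/
theorem le_const {c D : ℝ} (hc : 0 ≤ c) (z : ℝ) : c * expNegInvGlue (z / D) ≤ c := by
  have h1 : expNegInvGlue (z / D) ≤ 1 := by
    unfold expNegInvGlue
    split_ifs with h
    · exact zero_le_one
    · exact exp_le_one_iff.mpr (neg_nonpos.mpr (inv_nonneg.mpr (not_le.mp h).le))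
  calc c * expNegInvGlue (z / D) ≤ c * 1 := mul_le_mul_of_nonneg_left h1 hc
    _ = c := mul_one c

/-- `d/dz (c e^{-D/z}) = (D/z²) c e^{-D/z}` for `z ≠ 0`. [cite: Hamilton1997, §4.2, p. 53] -/
theorem hasDerivAt_exp {c D z : ℝ} (hz : z ≠ 0) :
    HasDerivAt (fun w ↦ c * exp (-D / w)) (D / z ^ 2 * (c * exp (-D / z))) z := by
  have h1 : HasDerivAt (fun w : ℝ ↦ -D / w) (D / z ^ 2) z := by
    have h := (hasDerivAt_inv hz).const_mul (-D)
    have hfun : (fun w : ℝ ↦ -D / w) = fun y ↦ -D * y⁻¹ := funext fun w ↦ div_eq_mul_inv _ _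
    rw [hfun]
    exact h.congr_deriv (by ring)
  exact ((h1.exp).const_mul c).congr_deriv (by ring)

/-- **`f' = (D/z²) f` on `z > 0`** for the smooth profile. [cite: Hamilton1997, §4.2, p. 53] -/
theorem hasDerivAt {c D z : ℝ} (hD : 0 < D) (hz : 0 < z) :
    HasDerivAt (fun w ↦ c * expNegInvGlue (w / D)) (D / z ^ 2 * (c * exp (-D / z))) z := by
  refine (hasDerivAt_exp (c := c) (D := D) hz.ne').congr_of_eventuallyEq ?_
  filter_upwards [Ioi_mem_nhds hz] with w hw
  exact eq_of_pos hD hw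

/-- `d/dz ((D/z²) c e^{-D/z}) = (D/z⁴)(D - 2z) c e^{-D/z}` for `z ≠ 0`.
[cite: Hamilton1997, §4.2, p. 53] -/
theorem hasDerivAt_deriv {c D z : ℝ} (hz : z ≠ 0) :
    HasDerivAt (fun w ↦ D / w ^ 2 * (c * exp (-D / w)))
      (D / z ^ 4 * (D - 2 * z) * (c * exp (-D / z))) z := by
  have h1 : HasDerivAt (fun w : ℝ ↦ D / w ^ 2) (-(2 * D) / z ^ 3) z := by
    have h := (hasDerivAt_const z D).div (hasDerivAt_pow 2 z) (pow_ne_zero 2 hz)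
    refine h.congr_deriv ?_
    simp only [Nat.cast_ofNat, Nat.add_one_sub_one, pow_one]
    field_simp
    ring
  refine (h1.mul (hasDerivAt_exp (c := c) (D := D) hz)).congr_deriv ?_
  field_simp
  ring

/-! ### Hamilton's elementary estimates (p. 53–54) -/

/-- **The estimates of Hamilton 1997, p. 53–54, for `φ = c e^{-D/z}` on `0 < z ≤ D/4`**
("If `p ≥ 4λ` then `p − 2z ≥ p/2` and `d²f/dz² ≥ (p²/2z⁴) f`. When `0 < z ≤ λ` we have
`f ≤ (z⁴/p²)·2 d²f/dz²`, `df/dz ≤ … d²f/dz²`, `(df/dz)² ≤ 2c d²f/dz²`"): with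
`φ₁ = (D/z²) φ`, `φ₂ = (D/z⁴)(D − 2z) φ` one has `0 < φ ≤ c`, `D² φ/(2z⁴) ≤ φ₂`, `φ ≤ (2z⁴/D²) φ₂`,
`φ₁ ≤ (2z²/D) φ₂`, `φ₁² ≤ 2c φ₂`, `φ₂ ≤ (D²/z⁴) φ`. [cite: Hamilton1997, §4.2, pp. 53–54] -/
theorem estimates {c D z : ℝ} (hc : 0 < c) (hD : 0 < D) (hz : 0 < z) (hzD : 4 * z ≤ D) :
    0 < c * exp (-D / z) ∧ c * exp (-D / z) ≤ c ∧
    D ^ 2 / (2 * z ^ 4) * (c * exp (-D / z)) ≤ D / z ^ 4 * (D - 2 * z) * (c * exp (-D / z)) ∧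
    c * exp (-D / z) ≤ 2 * z ^ 4 / D ^ 2 * (D / z ^ 4 * (D - 2 * z) * (c * exp (-D / z))) ∧
    D / z ^ 2 * (c * exp (-D / z)) ≤
      2 * z ^ 2 / D * (D / z ^ 4 * (D - 2 * z) * (c * exp (-D / z))) ∧
    (D / z ^ 2 * (c * exp (-D / z))) ^ 2 ≤
      2 * c * (D / z ^ 4 * (D - 2 * z) * (c * exp (-D / z))) ∧
    D / z ^ 4 * (D - 2 * z) * (c * exp (-D / z)) ≤ D ^ 2 / z ^ 4 * (c * exp (-D / z)) := by
  set φ := c * exp (-D / z) with hφ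
  have hφpos : 0 < φ := mul_pos hc (exp_pos _)
  have hφc : φ ≤ c := by
    have : exp (-D / z) ≤ 1 := exp_le_one_iff.mpr (by
      rw [neg_div]; exact neg_nonpos.mpr (div_nonneg hD.le hz.le))
    calc φ = c * exp (-D / z) := rfl
      _ ≤ c * 1 := mul_le_mul_of_nonneg_left this hc.le
      _ = c := mul_one c
  have hz2 : 0 < z ^ 2 := by positivity
  have hz4 : 0 < z ^ 4 := by positivity
  have hD2 : D / 2 ≤ D - 2 * z := by linarith
  refine ⟨hφpos, hφc, ?_, ?_, ?_, ?_, ?_⟩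
  · -- `D² φ/(2z⁴) ≤ φ₂`
    have : D ^ 2 / (2 * z ^ 4) * φ = D / z ^ 4 * (D / 2) * φ := by field_simp
    rw [this]
    gcongr
  · -- `φ ≤ (2z⁴/D²) φ₂`
    have e : 2 * z ^ 4 / D ^ 2 * (D / z ^ 4 * (D - 2 * z) * φ) = (2 * (D - 2 * z) / D) * φ := by
      field_simp
    rw [e]
    have : 1 ≤ 2 * (D - 2 * z) / D := by
      rw [le_div_iff₀ hD]; linarith
    nlinarith
  · -- `φ₁ ≤ (2z²/D) φ₂`
    have e : 2 * z ^ 2 / D * (D / z ^ 4 * (D - 2 * z) * φ) = (2 * (D - 2 * z)) / z ^ 2 * φ := by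
      field_simp
    rw [e]
    have : D / z ^ 2 ≤ 2 * (D - 2 * z) / z ^ 2 :=
      div_le_div_of_nonneg_right (by linarith) hz2.le
    exact mul_le_mul_of_nonneg_right this hφpos.le
  · -- `φ₁² ≤ 2c φ₂`
    have e1 : (D / z ^ 2 * φ) ^ 2 = (D / z ^ 4 * φ) * (D * φ) := by field_simp
    have e2 : 2 * c * (D / z ^ 4 * (D - 2 * z) * φ) = (D / z ^ 4 * φ) * (2 * c * (D - 2 * z)) := by
      ring
    rw [e1, e2]
    refine mul_le_mul_of_nonneg_left ?_ (by positivity)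
    nlinarith
  · -- `φ₂ ≤ (D²/z⁴) φ`
    have e : D ^ 2 / z ^ 4 * φ = D / z ^ 4 * D * φ := by field_simp
    rw [e]
    gcongr
    linarith

/-- **`x⁴ e^{-x} ≤ 4⁴ e^{-4}` for `x ≥ 0`** (p. 53: "since `y = x⁴ e^{-x}` has its maximum at
`x = 4`"); from `1 + t ≤ e^t` with `t = x/4 − 1`. [cite: Hamilton1997, §4.2, p. 53] -/
theorem pow_four_mul_exp_neg_le {x : ℝ} (hx : 0 ≤ x) : x ^ 4 * exp (-x) ≤ 256 * exp (-4) := by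
  have h1 : x / 4 ≤ exp (x / 4 - 1) := by
    have := add_one_le_exp (x / 4 - 1)
    linarith
  have h4 : (x / 4) ^ 4 ≤ exp (x / 4 - 1) ^ 4 := pow_le_pow_left₀ (by positivity) h1 4
  rw [← exp_nat_mul] at h4
  have e : ((4 : ℕ) : ℝ) * (x / 4 - 1) = x + -4 := by push_cast; ring
  rw [e, exp_add] at h4
  have hx4 : (x / 4) ^ 4 = x ^ 4 / 256 := by ring
  rw [hx4, div_le_iff₀ (by norm_num : (0:ℝ) < 256)] at h4
  have hex : 0 < exp (-x) := exp_pos _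
  calc x ^ 4 * exp (-x) ≤ exp x * exp (-4) * 256 * exp (-x) :=
        mul_le_mul_of_nonneg_right h4 hex.le
    _ = 256 * exp (-4) := by
        have : exp x * exp (-x) = 1 := by rw [← exp_add, add_neg_cancel, exp_zero]
        linear_combination (exp (-4) * 256) * this

/-- **`φ₂ ≤ 256 e^{-4} c/D²`** on `z > 0` (p. 53: "`d²f/dz² ≤ (p²/(z−λ)⁴) f`" and the maximum of
`x⁴ e^{-x}`), for `c ≥ 0`, `D > 0`. [cite: Hamilton1997, §4.2, p. 53] -/
theorem deriv2_le {c D z : ℝ} (hc : 0 ≤ c) (hD : 0 < D) (hz : 0 < z) :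
    D / z ^ 4 * (D - 2 * z) * (c * exp (-D / z)) ≤ 256 * exp (-4) * c / D ^ 2 := by
  have hφ : 0 ≤ c * exp (-D / z) := mul_nonneg hc (exp_pos _).le
  have hz4 : 0 < z ^ 4 := by positivity
  have step1 : D / z ^ 4 * (D - 2 * z) * (c * exp (-D / z)) ≤ D / z ^ 4 * D * (c * exp (-D / z)) := by
    gcongr
    linarith
  have key := pow_four_mul_exp_neg_le (x := D / z) (div_nonneg hD.le hz.le)
  have e : D / z ^ 4 * D * (c * exp (-D / z)) = c / D ^ 2 * ((D / z) ^ 4 * exp (-(D / z))) := by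
    rw [neg_div]
    field_simp
  rw [e] at step1
  calc D / z ^ 4 * (D - 2 * z) * (c * exp (-D / z)) ≤ c / D ^ 2 * ((D / z) ^ 4 * exp (-(D / z))) :=
        step1
    _ ≤ c / D ^ 2 * (256 * exp (-4)) := mul_le_mul_of_nonneg_left key (by positivity)
    _ = 256 * exp (-4) * c / D ^ 2 := by ring

/-- **`e^{2φ} − 1 ≤ 2 e^{2c} φ` for `0 ≤ φ ≤ c`** (p. 54: "`e^{2f} − 1 ≤ 2e^{2c} f`"; from
`e^y − 1 ≤ y e^y`, `y ≥ 0`). [cite: Hamilton1997, §4.2, p. 54] -/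
theorem exp_two_mul_sub_one_le {φ c : ℝ} (hφ : 0 ≤ φ) (hφc : φ ≤ c) :
    exp (2 * φ) - 1 ≤ 2 * exp (2 * c) * φ := by
  have h1 : exp (2 * φ) - 1 ≤ 2 * φ * exp (2 * φ) := by
    -- `1 − y ≤ e^{-y}` with `y = 2φ`, multiplied by `e^{y}`
    have h := add_one_le_exp (-(2 * φ))
    have hpos : 0 < exp (2 * φ) := exp_pos _
    have hmul := mul_le_mul_of_nonneg_left h hpos.le
    rw [← exp_add, add_neg_cancel, exp_zero] at hmul
    nlinarith
  have h2 : exp (2 * φ) ≤ exp (2 * c) := exp_le_exp.mpr (by linarith)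
  nlinarith [exp_pos (2 * c)]

/-- **Hamilton 1997, Lemma D2.4** ("For any `λ` and any `δ > 0` we can choose `c` small enough and
`p` large enough so that when `f = c e^{-p/(z−λ)}`: `e^{2f} − 1 ≤ δ d²f/dz²`, `df/dz ≤ δ d²f/dz²`,
`(df/dz)² ≤ δ d²f/dz²` and `d²f/dz² ≤ δ` for `λ < z ≤ 4λ`"), with `λ = 0` and an arbitrary
length `Z` in place of `4λ`: for all `Z, δ > 0` there are `c₀, D₀ > 0` such that for
`0 < c ≤ c₀`, `D ≥ D₀` and `0 < z ≤ Z`, writing `φ = c e^{-D/z}`, `φ₁ = (D/z²) φ = φ'`,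
`φ₂ = (D/z⁴)(D−2z) φ = φ''`: `φ₂ > 0`, `e^{2φ} − 1 ≤ δ φ₂`, `φ₁ ≤ δ φ₂`, `φ₁² ≤ δ φ₂`, `φ₂ ≤ δ`
and `φ ≤ δ φ₂`. [cite: Hamilton1997, §4.2, Lemma 2.4 (p. 54)] -/
theorem hamilton_lemma_D2_4 {Z δ : ℝ} (hZ : 0 < Z) (hδ : 0 < δ) :
    ∃ c₀ : ℝ, 0 < c₀ ∧ ∃ D₀ : ℝ, 0 < D₀ ∧ ∀ c D z : ℝ, 0 < c → c ≤ c₀ → D₀ ≤ D → 0 < z → z ≤ Z →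
      0 < D / z ^ 4 * (D - 2 * z) * (c * exp (-D / z)) ∧
      exp (2 * (c * exp (-D / z))) - 1 ≤ δ * (D / z ^ 4 * (D - 2 * z) * (c * exp (-D / z))) ∧
      D / z ^ 2 * (c * exp (-D / z)) ≤ δ * (D / z ^ 4 * (D - 2 * z) * (c * exp (-D / z))) ∧
      (D / z ^ 2 * (c * exp (-D / z))) ^ 2 ≤ δ * (D / z ^ 4 * (D - 2 * z) * (c * exp (-D / z))) ∧
      D / z ^ 4 * (D - 2 * z) * (c * exp (-D / z)) ≤ δ ∧
      c * exp (-D / z) ≤ δ * (D / z ^ 4 * (D - 2 * z) * (c * exp (-D / z))) := by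
  refine ⟨min 1 (δ / 256), lt_min one_pos (by positivity),
    max (4 * Z) (max 1 (max (2 * Z ^ 2 / δ) (4 * exp 2 * Z ^ 4 / δ + 1))),
    lt_max_of_lt_left (by positivity), ?_⟩
  intro c D z hc hcc₀ hDD₀ hz hzZ
  have hc1 : c ≤ 1 := hcc₀.trans (min_le_left _ _)
  have hcδ : c ≤ δ / 256 := hcc₀.trans (min_le_right _ _)
  have hD4Z : 4 * Z ≤ D := (le_max_left _ _).trans hDD₀
  have hD1 : 1 ≤ D := ((le_max_left _ _).trans (le_max_right _ _)).trans hDD₀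
  have hDZ2 : 2 * Z ^ 2 / δ ≤ D :=
    (((le_max_left _ _).trans (le_max_right _ _)).trans (le_max_right _ _)).trans hDD₀
  have hDZ4 : 4 * exp 2 * Z ^ 4 / δ + 1 ≤ D :=
    (((le_max_right _ _).trans (le_max_right _ _)).trans (le_max_right _ _)).trans hDD₀
  have hD : 0 < D := by linarith
  have hzD : 4 * z ≤ D := by linarith
  obtain ⟨hφpos, hφc, hlow, hφ, hφ₁, hφ₁sq, -⟩ := estimates hc hD hz hzD
  set φ := c * exp (-D / z) with hφdef
  set φ₂ := D / z ^ 4 * (D - 2 * z) * φ with hφ₂def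
  have hz4 : 0 < z ^ 4 := by positivity
  have hD2pos : 0 < D ^ 2 := by positivity
  have hφ₂pos : 0 < φ₂ := lt_of_lt_of_le (by positivity) hlow
  have hD2 : D ≤ D ^ 2 := by nlinarith
  have hδD2 : δ * D ≤ δ * D ^ 2 := mul_le_mul_of_nonneg_left hD2 hδ.le
  have hzZ4 : z ^ 4 ≤ Z ^ 4 := pow_le_pow_left₀ hz.le hzZ 4
  have hzZ2 : z ^ 2 ≤ Z ^ 2 := pow_le_pow_left₀ hz.le hzZ 2
  have hE : (3 : ℝ) ≤ exp 2 := by have := add_one_le_exp (2 : ℝ); linarith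
  have hE0 : (0 : ℝ) ≤ 4 * exp 2 := by positivity
  -- `4e² Z⁴ ≤ δ D`, `2 Z² ≤ δ D`
  have hA : 4 * exp 2 * Z ^ 4 ≤ δ * D := by
    have h1 : 4 * exp 2 * Z ^ 4 / δ ≤ D := by linarith
    rwa [div_le_iff₀' hδ] at h1
  have hB : 2 * Z ^ 2 ≤ δ * D := by rwa [div_le_iff₀' hδ] at hDZ2
  have hzZ4' : 4 * exp 2 * z ^ 4 ≤ 4 * exp 2 * Z ^ 4 := mul_le_mul_of_nonneg_left hzZ4 hE0
  have hk1 : 2 * z ^ 4 / D ^ 2 ≤ δ := by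
    rw [div_le_iff₀ hD2pos]
    nlinarith [pow_nonneg hz.le 4]
  have hk2 : 2 * z ^ 2 / D ≤ δ := by
    rw [div_le_iff₀ hD]
    linarith
  have hk3 : 4 * exp 2 * z ^ 4 / D ^ 2 ≤ δ := by
    rw [div_le_iff₀ hD2pos]
    linarith
  refine ⟨hφ₂pos, ?_, ?_, ?_, ?_, ?_⟩
  · -- `e^{2φ} − 1 ≤ 2e^{2c} φ ≤ 2e² (2z⁴/D²) φ₂ ≤ δ φ₂`
    have h1 := exp_two_mul_sub_one_le hφpos.le hφc
    have h2 : exp (2 * c) ≤ exp 2 := exp_le_exp.mpr (by linarith)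
    have h3 : 2 * exp (2 * c) * φ ≤ 2 * exp 2 * (2 * z ^ 4 / D ^ 2 * φ₂) := by
      gcongr
    calc exp (2 * φ) - 1 ≤ 2 * exp (2 * c) * φ := h1
      _ ≤ 2 * exp 2 * (2 * z ^ 4 / D ^ 2 * φ₂) := h3
      _ = (4 * exp 2 * z ^ 4 / D ^ 2) * φ₂ := by ring
      _ ≤ δ * φ₂ := mul_le_mul_of_nonneg_right hk3 hφ₂pos.le
  · exact hφ₁.trans (mul_le_mul_of_nonneg_right hk2 hφ₂pos.le)
  · calc (D / z ^ 2 * φ) ^ 2 ≤ 2 * c * φ₂ := hφ₁sq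
      _ ≤ δ * φ₂ := mul_le_mul_of_nonneg_right (by linarith) hφ₂pos.le
  · have he : exp (-4) ≤ 1 := exp_le_one_iff.mpr (by norm_num)
    have hD21 : (1 : ℝ) ≤ D ^ 2 := by nlinarith
    calc φ₂ ≤ 256 * exp (-4) * c / D ^ 2 := deriv2_le hc.le hD hz
      _ ≤ 256 * exp (-4) * c := div_le_self (by positivity) hD21
      _ ≤ 256 * 1 * c := by gcongr
      _ ≤ δ := by linarith
  · exact hφ.trans (mul_le_mul_of_nonneg_right hk1 hφ₂pos.le)

end SurgeryProfile

end Literature.Geometry.Riemannian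

end
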